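import Mathlib
import HarnessLib
import Summits.Ventures.LatticeQCDFlow.Scoring.RestartChainAutocorrelation
import Summits.Ventures.LatticeQCDFlow.Exactness.NCMCGeneralSpaceDissipation

/-!
# Jarzynski weights along the restart chain: unbiased for `Z₁/Z₀` at every stride, with
# autocorrelations equal to the prior chain's autocorrelations of `h(x) = E[e^{−W} | start x]`

HONEST FRAMING: exact (Metropolis-corrected) sampling algorithms for lattice gauge theory;
figures of merit are autocorrelation/cost numbers at stated couplings and volumes; no
continuum-physics claim.

Venture `LatticeQCDFlow` (cell pub-lqcd), topic `Scoring`; FANOUT row 8 (`s0-cpn-nemc`, GEN-12 —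
the S0-D2 protocol itself: Bonanno–Nada–Vadacchino 2024 start each non-equilibrium evolution from
the current state of an equilibrium PRIOR (open-boundary) chain, `n_between` sweeps apart, and
average the Jarzynski weights `e^{−W}`; NAMED ONLY).  NEW WORK of the cell, not a published result;
no definition is introduced.  The instantiation of `Scoring/RestartChainAutocorrelation.lean` (the
restart law) on a Crooks pair of row 13's `Exactness/NCMCGeneralSpace*.lean` (`CrooksPair`,
`fwdPathLaw`, Jarzynski as a real expectation `integral_exp_neg_work` of
`NCMCGeneralSpaceDissipation.lean`).

## Content (a Crooks pair `(κF, κR, s, e, W)` from `ν₀` to `ν₁`, `κF`, `κR` Markov, `Z₀ = ν₀(Ω)`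
## finite non-zero; the prior chain `κ₀` with invariant probability law `π₀ = Z₀⁻¹ • ν₀`; the restart
## chain `K = prodMkRight E κ₀ ⊗ₖ prodMkLeft (Ω × E) κF` on `Ω × E` with invariant law `Π = π₀ ⊗ₘ κF`)

* **`restart_jarzynski_mean`** — `∫ e^{−W(ω)} dΠ(x, ω) = Z₁/Z₀`: the stationary mean of the Jarzynski
  weight along the restart chain is the ratio of partition functions WHATEVER the stride and the
  prior chain's autocorrelations (unbiasedness of the correlated-restart estimator in expectation;
  its VARIANCE is what the restart law prices);
* `condMean_jarzynski_centred`, `integral_condMean_jarzynski_centred` — the conditional mean of the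
  centred weight `e^{−W} − Z₁/Z₀` is `h − Z₁/Z₀`, `h(x) = ∫ e^{−W} dκF(x)`, and it is `π₀`-centred;
* **`restart_jarzynski_autocov_succ`** — under a work floor `W ≥ W_lo` (so the weight is bounded):
  `C^K_{e^{−W} − Z₁/Z₀}(t + 1) = C^{κ₀}_{h − Z₁/Z₀}(t + 1)` for every `t` — the weight autocovariances
  ARE the prior chain's autocovariances of the conditional Jarzynski mean;
* **`restart_jarzynski_tauInt_le_of_doeblin`** — a Doeblin constant `ε₀ > 0` of the prior chain by
  `π₀` gives `τ_int(weights) ≤ 1/ε₀ − 1/2`; `restart_jarzynski_autocov_succ_nHit` — with the prior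
  chain run `m` sweeps between evolutions (`κ₀ = nHit κ m`): `C^K(t + 1) = C^{κ}_{h − Z₁/Z₀}(m(t + 1))`.

Reading (value-free, for row 8's RESULTS §7–§11 and rows 13 / 19 / 23 / 24): `n_between` matters
only through the prior sweep's autocorrelation of `h(x) = E[e^{−W} | x]` at stride `n_between`, and
the dilution law of the parent file says the weight sequence's `τ_int − 1/2` is that of `h` times
`Var h / Var e^{−W} ≤ 1`.  NOT CLAIMED: any number of ours; the ratio-estimator / Kish-ESS
combination (markdown); protocols without a work floor (then `e^{−W}` is unbounded and the bounded-
observable theorems do not apply as stated).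
-/

noncomputable section

namespace Summit.Ventures.LatticeQCDFlow.Scoring

open MeasureTheory ProbabilityTheory Filter Set Summit.Ventures.LatticeQCDFlow.Exactness
open Summit.Ventures.LatticeQCDFlow.Exactness.GeneralNCMC
open scoped ENNReal

variable {Ω E : Type*} [MeasurableSpace Ω] [MeasurableSpace E]
  {ν₀ ν₁ : Measure Ω} [IsFiniteMeasure ν₀] [IsFiniteMeasure ν₁] {κF κR : Kernel Ω E}
  [IsMarkovKernel κF] [IsMarkovKernel κR] {s e : E → Ω} {W : E → ℝ}
  {κ₀ : Kernel Ω Ω} [IsMarkovKernel κ₀] {π₀ : Measure Ω} [IsProbabilityMeasure π₀]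

omit [IsFiniteMeasure ν₀] [IsFiniteMeasure ν₁] [IsMarkovKernel κ₀] in
/-- **Unbiasedness at every stride**: with `π₀ = Z₀⁻¹ • ν₀` the stationary mean of the Jarzynski
weight along the restart chain is `∫ e^{−W(ω)} d(π₀ ⊗ₘ κF)(x, ω) = Z₁/Z₀`. -/
theorem restart_jarzynski_mean (h : CrooksPair ν₀ ν₁ κF κR s e W) (hπ₀ : π₀ = (ν₀ univ)⁻¹ • ν₀) :
    ∫ p, Real.exp (-W p.2) ∂(π₀ ⊗ₘ κF) = ((ν₀ univ)⁻¹ * ν₁ univ).toReal := by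
  have hWm : Measurable fun ω => Real.exp (-W ω) := Real.measurable_exp.comp h.measurable_W.neg
  have h1 : ∫ p, Real.exp (-W p.2) ∂(π₀ ⊗ₘ κF)
      = ∫ ω, Real.exp (-W ω) ∂((π₀ ⊗ₘ κF).map Prod.snd) :=
    (integral_map measurable_snd.aemeasurable hWm.aestronglyMeasurable).symm
  have h2 : (π₀ ⊗ₘ κF).map Prod.snd = fwdPathLaw ν₀ κF := by
    rw [← Measure.snd, Measure.snd_compProd, hπ₀, Measure.bind_smul]
    rfl
  rw [h1, h2, h.integral_exp_neg_work]

omit [IsFiniteMeasure ν₀] [IsFiniteMeasure ν₁] [IsMarkovKernel κR] [IsMarkovKernel κ₀]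
  [IsProbabilityMeasure π₀] in
/-- The conditional mean of the centred weight is the centred conditional Jarzynski mean:
`∫ (e^{−W} − c) dκF(x) = h(x) − c`, `h(x) = ∫ e^{−W} dκF(x)`, under a work floor. -/
theorem condMean_jarzynski_centred (h : CrooksPair ν₀ ν₁ κF κR s e W) {Wlo : ℝ}
    (hlo : ∀ ω, Wlo ≤ W ω) (c : ℝ) :
    (fun x => ∫ ω, (fun p : Ω × E => Real.exp (-W p.2) - c) (x, ω) ∂(κF x))
      = fun x => (∫ ω, Real.exp (-W ω) ∂(κF x)) - c := by
  funext x
  have hWm : Measurable fun ω => Real.exp (-W ω) := Real.measurable_exp.comp h.measurable_W.neg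
  have hint : Integrable (fun ω => Real.exp (-W ω)) (κF x) :=
    integrable_of_bounded _ hWm (C := Real.exp (-Wlo)) fun ω => by
      rw [abs_of_pos (Real.exp_pos _)]; exact Real.exp_le_exp.2 (neg_le_neg (hlo ω))
  show ∫ ω, (Real.exp (-W ω) - c) ∂(κF x) = _
  rw [integral_sub hint (integrable_const c), integral_const, probReal_univ, one_smul]

omit [IsFiniteMeasure ν₀] [IsFiniteMeasure ν₁] [IsMarkovKernel κ₀] in
/-- … and it is `π₀`-centred for `c = Z₁/Z₀`. -/
theorem integral_condMean_jarzynski_centred (h : CrooksPair ν₀ ν₁ κF κR s e W)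
    (hπ₀ : π₀ = (ν₀ univ)⁻¹ • ν₀) {Wlo : ℝ} (hlo : ∀ ω, Wlo ≤ W ω) :
    ∫ x, ((∫ ω, Real.exp (-W ω) ∂(κF x)) - ((ν₀ univ)⁻¹ * ν₁ univ).toReal) ∂π₀ = 0 := by
  have hGm : Measurable fun p : Ω × E => Real.exp (-W p.2) - ((ν₀ univ)⁻¹ * ν₁ univ).toReal :=
    (Real.measurable_exp.comp (h.measurable_W.comp measurable_snd).neg).sub measurable_const
  have hGb : ∀ p : Ω × E, |Real.exp (-W p.2) - ((ν₀ univ)⁻¹ * ν₁ univ).toReal|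
      ≤ Real.exp (-Wlo) + |((ν₀ univ)⁻¹ * ν₁ univ).toReal| := fun p =>
    (abs_sub _ _).trans (add_le_add (by
      rw [abs_of_pos (Real.exp_pos _)]; exact Real.exp_le_exp.2 (neg_le_neg (hlo p.2))) le_rfl)
  have hc := congrFun (condMean_jarzynski_centred h hlo ((ν₀ univ)⁻¹ * ν₁ univ).toReal)
  have hmean := integral_condMean (κF := κF) (π₀ := π₀) hGm hGb
  simp only [hc] at hmean
  rw [hmean]
  have hint : Integrable (fun p : Ω × E => Real.exp (-W p.2)) (π₀ ⊗ₘ κF) :=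
    integrable_of_bounded _ (Real.measurable_exp.comp (h.measurable_W.comp measurable_snd).neg)
      (C := Real.exp (-Wlo)) fun p => by
        rw [abs_of_pos (Real.exp_pos _)]; exact Real.exp_le_exp.2 (neg_le_neg (hlo p.2))
  rw [integral_sub hint (integrable_const _), integral_const, probReal_univ, one_smul,
    restart_jarzynski_mean h hπ₀, sub_self]

omit [IsFiniteMeasure ν₀] [IsFiniteMeasure ν₁] [IsMarkovKernel κR] in
/-- **THE WEIGHT AUTOCOVARIANCES ARE THE PRIOR CHAIN'S**: under a work floor `W ≥ W_lo`, for every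
`t` and every constant `c` (take `c = Z₁/Z₀` to centre):
`autocov K (π₀ ⊗ₘ κF) (e^{−W} − c) (t + 1) = autocov κ₀ π₀ (h − c) (t + 1)`. -/
theorem restart_jarzynski_autocov_succ (h : CrooksPair ν₀ ν₁ κF κR s e W) {Wlo : ℝ}
    (hlo : ∀ ω, Wlo ≤ W ω) (c : ℝ) (t : ℕ) :
    autocov ((Kernel.prodMkRight E κ₀) ⊗ₖ (Kernel.prodMkLeft (Ω × E) κF)) (π₀ ⊗ₘ κF)
        (fun p => Real.exp (-W p.2) - c) (t + 1)
      = autocov κ₀ π₀ (fun x => (∫ ω, Real.exp (-W ω) ∂(κF x)) - c) (t + 1) := by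
  have hGm : Measurable fun p : Ω × E => Real.exp (-W p.2) - c :=
    (Real.measurable_exp.comp (h.measurable_W.comp measurable_snd).neg).sub measurable_const
  have hGb : ∀ p : Ω × E, |Real.exp (-W p.2) - c| ≤ Real.exp (-Wlo) + |c| := fun p =>
    (abs_sub _ _).trans (add_le_add (by
      rw [abs_of_pos (Real.exp_pos _)]; exact Real.exp_le_exp.2 (neg_le_neg (hlo p.2))) le_rfl)
  rw [autocov_restart_succ hGm hGb t, condMean_jarzynski_centred h hlo c]

omit [IsFiniteMeasure ν₀] [IsFiniteMeasure ν₁] in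
/-- **`τ_int(weights) ≤ 1/ε₀ − 1/2`**: a Doeblin constant `ε₀ > 0` of the PRIOR chain by
`π₀ = Z₀⁻¹ • ν₀` bounds the integrated autocorrelation time of the centred Jarzynski weights
`e^{−W} − Z₁/Z₀` along the restart chain, under a work floor — whatever the evolutions do. -/
theorem restart_jarzynski_tauInt_le_of_doeblin (h : CrooksPair ν₀ ν₁ κF κR s e W)
    (hπ₀ : π₀ = (ν₀ univ)⁻¹ • ν₀) (hinv : Kernel.Invariant κ₀ π₀) {ε : ℝ≥0∞}
    (hmin : ∀ x {B : Set Ω}, MeasurableSet B → ε * π₀ B ≤ κ₀ x B) (hε0 : 0 < ε) {Wlo : ℝ}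
    (hlo : ∀ ω, Wlo ≤ W ω) :
    tauInt (fun t =>
        autocov ((Kernel.prodMkRight E κ₀) ⊗ₖ (Kernel.prodMkLeft (Ω × E) κF)) (π₀ ⊗ₘ κF)
            (fun p => Real.exp (-W p.2) - ((ν₀ univ)⁻¹ * ν₁ univ).toReal) t
          / autocov ((Kernel.prodMkRight E κ₀) ⊗ₖ (Kernel.prodMkLeft (Ω × E) κF)) (π₀ ⊗ₘ κF)
            (fun p => Real.exp (-W p.2) - ((ν₀ univ)⁻¹ * ν₁ univ).toReal) 0)
      ≤ 1 / ε.toReal - 1 / 2 := by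
  have hGm : Measurable fun p : Ω × E => Real.exp (-W p.2) - ((ν₀ univ)⁻¹ * ν₁ univ).toReal :=
    (Real.measurable_exp.comp (h.measurable_W.comp measurable_snd).neg).sub measurable_const
  have hGb : ∀ p : Ω × E, |Real.exp (-W p.2) - ((ν₀ univ)⁻¹ * ν₁ univ).toReal|
      ≤ Real.exp (-Wlo) + |((ν₀ univ)⁻¹ * ν₁ univ).toReal| := fun p =>
    (abs_sub _ _).trans (add_le_add (by
      rw [abs_of_pos (Real.exp_pos _)]; exact Real.exp_le_exp.2 (neg_le_neg (hlo p.2))) le_rfl)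
  have hG0 : ∫ p, (Real.exp (-W p.2) - ((ν₀ univ)⁻¹ * ν₁ univ).toReal) ∂(π₀ ⊗ₘ κF) = 0 := by
    have hint : Integrable (fun p : Ω × E => Real.exp (-W p.2)) (π₀ ⊗ₘ κF) :=
      integrable_of_bounded _ (Real.measurable_exp.comp (h.measurable_W.comp measurable_snd).neg)
        (C := Real.exp (-Wlo)) fun p => by
          rw [abs_of_pos (Real.exp_pos _)]; exact Real.exp_le_exp.2 (neg_le_neg (hlo p.2))
    rw [integral_sub hint (integrable_const _), integral_const, probReal_univ, one_smul,
      restart_jarzynski_mean h hπ₀, sub_self]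
  exact tauInt_restart_le_of_doeblin (κF := κF) hinv hmin hε0 hGm hGb hG0

omit [IsFiniteMeasure ν₀] [IsFiniteMeasure ν₁] [IsMarkovKernel κR] [IsMarkovKernel κ₀] in
/-- **Stride dictionary**: with `n_between = m` sweeps of a kernel `κ` between evolutions
(`κ₀ = nHit κ m`): `C^K_{e^{−W} − c}(t + 1) = C^{κ}_{h − c}(m (t + 1))`. -/
theorem restart_jarzynski_autocov_succ_nHit (h : CrooksPair ν₀ ν₁ κF κR s e W) {Wlo : ℝ}
    (hlo : ∀ ω, Wlo ≤ W ω) (κ : Kernel Ω Ω) [IsMarkovKernel κ] (m : ℕ) (c : ℝ) (t : ℕ) :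
    autocov ((Kernel.prodMkRight E (nHit κ m)) ⊗ₖ (Kernel.prodMkLeft (Ω × E) κF)) (π₀ ⊗ₘ κF)
        (fun p => Real.exp (-W p.2) - c) (t + 1)
      = autocov κ π₀ (fun x => (∫ ω, Real.exp (-W ω) ∂(κF x)) - c) (m * (t + 1)) := by
  have hGm : Measurable fun p : Ω × E => Real.exp (-W p.2) - c :=
    (Real.measurable_exp.comp (h.measurable_W.comp measurable_snd).neg).sub measurable_const
  have hGb : ∀ p : Ω × E, |Real.exp (-W p.2) - c| ≤ Real.exp (-Wlo) + |c| := fun p =>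
    (abs_sub _ _).trans (add_le_add (by
      rw [abs_of_pos (Real.exp_pos _)]; exact Real.exp_le_exp.2 (neg_le_neg (hlo p.2))) le_rfl)
  rw [autocov_restart_succ_nHit (π₀ := π₀) κ m hGm hGb t, condMean_jarzynski_centred h hlo c]

end Summit.Ventures.LatticeQCDFlow.Scoring

end
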